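import Literature.NumberTheory.DiophantineGeometry.AbcShapeLPInstance
import Literature.NumberTheory.DiophantineGeometry.AbcShapeReductionCount
import Literature.NumberTheory.Sieve.DivisorBound
import HarnessLib

/-!
# The endgame for `λ < 1`: `B_d ≪ C₀^{0.6 + o(1)}` on admissible data (BBLT §6)

From `log_Λ B_d ≤ 3/5 + 2s` (`AbcShapes.logb_shapeCount_le`, `Λ = 2C₀`,
`s = (12d+3) log_Λ D_τ + 30 log_Λ 2 + log_Λ V₂`) and the divisor bound `D_τ ≤ C_τ T^{η/m}`
(`T = V₂ Λ`, `m = 2(12d+3)`) we get, for data admissible for `(λ, ε)` with `λ + 3ε ≤ 1`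
(this is where `λ < 1` enters: it gives `∏ XᵢYᵢZᵢ ≤ Λ^{λ+3ε} ≤ Λ`),

> `B_d(c; X, Y, Z) ≤ K · C₀^{3/5 + η}` (`AbcShapes.shapeCount_le_of_admissible_lt_one`),

in dimension `d = 6 + e`, with `K` depending only on `e, η`. Combined with the reduction
`abcExponentCount_le_of_shapeCount_le` this proves Theorem 1.3 of [BernertEtAl2024]
(arXiv v2); the discharge `bernertEtAl2024_thm_1_3_holds` of that named fact is in
`AbcExceptionalSetBoundsMainProofs`.

## References

* [BernertEtAl2024] C. Bernert, T. Browning, J. D. Lichtman, J. Teräväinen, *Bounds on the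
  exceptional set in the abc conjecture*, arXiv:2410.12234v2, §6 (proof of Theorem 1.3).
-/

noncomputable section

open Finset

namespace Literature.NumberTheory.DiophantineGeometry

namespace AbcShapes

/-- **`B_d ≪ C₀^{3/5 + η}` on admissible data when `λ + 3ε ≤ 1`** [BernertEtAl2024, §6]: for
`λ + 3ε ≤ 1`, `0 < η` and dimension `d = 6 + e` there is `K ≥ 0` with
`B_d(c; X, Y, Z) ≤ K C₀^{3/5 + η}` for all `(C₀; c; X, Y, Z)` admissible for `(λ, ε)`
(`AbcShapes.Admissible`). [cite: BernertEtAl2024, Thm. 1.3 and §6 (arXiv v2)] -/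
theorem shapeCount_le_of_admissible_lt_one (e : ℕ) {ε l : ℝ} (hl1 : l + 3 * ε ≤ 1) {η : ℝ}
    (hη : 0 < η) :
    ∃ K : ℝ, 0 ≤ K ∧ ∀ (C₀ c₁ c₂ c₃ : ℕ) (X Y Z : Fin (6 + e) → ℕ),
      Admissible l ε C₀ c₁ c₂ c₃ X Y Z →
        (shapeCount c₁ c₂ c₃ X Y Z : ℝ) ≤ K * (C₀ : ℝ) ^ (3 / 5 + η) := by
  classical
  -- the constant `V₂ = ∏ 2^{i+1}`
  obtain ⟨V2, hV2⟩ : ∃ V : ℕ, V = shapeVal (fun _ : Fin (6 + e) => 2) := ⟨_, rfl⟩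
  have hV2pos : 0 < V2 := by rw [hV2]; exact shapeVal_pos fun _ => two_pos
  have hV2r : (0 : ℝ) < V2 := by exact_mod_cast hV2pos
  -- the exponent multiplier `m = 2(12d+3)` and the divisor bound with exponent `η / m`
  obtain ⟨m, hm⟩ : ∃ m : ℝ, m = 2 * (12 * ((6 + e : ℕ) : ℝ) + 3) := ⟨_, rfl⟩
  have hm0 : 0 < m := by rw [hm]; positivity
  have hηm : 0 < η / m := by positivity
  obtain ⟨Cτ, hCτ1, hCτ⟩ := Literature.NumberTheory.Sieve.exists_card_divisors_le_mul_rpow hηm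
  have hCτ0 : 0 < Cτ := by linarith
  -- the constant
  obtain ⟨K, hK⟩ : ∃ K : ℝ, K = (2 : ℝ) ^ (3 / 5 + η) * ((2 : ℝ) ^ (60 : ℝ) * (V2 : ℝ) ^ (2 : ℝ)) *
      (Cτ ^ m * (V2 : ℝ) ^ η) := ⟨_, rfl⟩
  have hK0 : 0 ≤ K := by rw [hK]; positivity
  refine ⟨K, hK0, fun C₀ c₁ c₂ c₃ X Y Z hA => ?_⟩
  obtain ⟨hC₀1, hc₁, hc₂, hc₃, -, -, -, hXp, hYp, hZp, hPle, hvX, hvY, hvZ, hC₀le⟩ := hA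
  have hC₀ : (0 : ℝ) < C₀ := by exact_mod_cast hC₀1
  have hKC : 0 ≤ K * (C₀ : ℝ) ^ (3 / 5 + η) := by positivity
  rcases Nat.eq_zero_or_pos (shapeCount c₁ c₂ c₃ X Y Z) with hB0 | hBpos
  · rw [hB0, Nat.cast_zero]; exact hKC
  -- `T = V₂ · 2C₀` and `D_τ = ⌊C_τ T^{η/m}⌋`
  obtain ⟨T, hT⟩ : ∃ T : ℕ, T = V2 * (2 * C₀) := ⟨_, rfl⟩
  have hT1 : 1 ≤ T := by rw [hT]; exact Nat.mul_pos hV2pos (by omega)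
  have hTval : ∀ {c : ℕ} {W : Fin (6 + e) → ℕ}, c * shapeVal W ≤ 2 * C₀ →
      c * shapeVal (fun i => 2 * W i) ≤ T := by
    intro c W hW
    calc c * shapeVal (fun i => 2 * W i) = V2 * (c * shapeVal W) := by
          rw [show (fun i => 2 * W i) = fun i => (fun _ : Fin (6 + e) => 2) i * W i from rfl,
            shapeVal_mul, ← hV2]; ring
      _ ≤ V2 * (2 * C₀) := Nat.mul_le_mul_left _ hW
      _ = T := hT.symm
  obtain ⟨Dτ, hDτ⟩ : ∃ D : ℕ, D = ⌊Cτ * (T : ℝ) ^ (η / m)⌋₊ := ⟨_, rfl⟩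
  have hD : ∀ n : ℕ, n ≠ 0 → n ≤ T → n.divisors.card ≤ Dτ := by
    intro n hn hnT
    rw [hDτ]
    refine Nat.le_floor ((hCτ n hn).trans ?_)
    exact mul_le_mul_of_nonneg_left (Real.rpow_le_rpow (Nat.cast_nonneg _)
      (by exact_mod_cast hnT) hηm.le) hCτ0.le
  have hD1 : 1 ≤ Dτ := by simpa using hD 1 one_ne_zero hT1
  have hDreal : (Dτ : ℝ) ≤ Cτ * (T : ℝ) ^ (η / m) := by rw [hDτ]; exact Nat.floor_le (by positivity)
  have hDpos : (0 : ℝ) < Dτ := by exact_mod_cast hD1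
  -- the linear programme (`t = λ + 3ε ≤ 1`)
  have hlog := logb_shapeCount_le hc₁ hc₂ hc₃ hC₀1 hXp hYp hZp (hTval hvX) (hTval hvY) (hTval hvZ)
    hD hC₀le hvX hvY hvZ hPle hl1 hBpos
  rw [← hV2] at hlog
  obtain ⟨Λ, hΛdef⟩ : ∃ Λ : ℝ, Λ = 2 * C₀ := ⟨_, rfl⟩
  rw [← hΛdef] at hlog
  have hΛ : 1 < Λ := by
    have : (1 : ℝ) ≤ C₀ := by exact_mod_cast hC₀1
    rw [hΛdef]; linarith
  have hΛ0 : 0 < Λ := by linarith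
  have hT' : (T : ℝ) = V2 * Λ := by rw [hT, hΛdef]; push_cast; ring
  have hBreal : (0 : ℝ) < shapeCount c₁ c₂ c₃ X Y Z := by exact_mod_cast hBpos
  -- `Λ^{c log_Λ x} = x^c`
  have hpowlog : ∀ {x : ℝ} (c : ℝ), 0 < x → Λ ^ (c * Real.logb Λ x) = x ^ c := by
    intro x c hx
    rw [mul_comm, Real.rpow_mul hΛ0.le, Real.rpow_logb hΛ0 hΛ.ne' hx]
  -- `B = Λ^{log_Λ B} ≤ Λ^{3/5 + 2s} = Λ^{3/5} · D_τ^m · 2^60 · V₂^2`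
  have hstep : (shapeCount c₁ c₂ c₃ X Y Z : ℝ) ≤
      Λ ^ (3 / 5 : ℝ) * ((Dτ : ℝ) ^ m * ((2 : ℝ) ^ (60 : ℝ) * (V2 : ℝ) ^ (2 : ℝ))) := by
    have e1 : 3 / 5 + 2 * ((12 * ((6 + e : ℕ) : ℝ) + 3) * Real.logb Λ Dτ + 30 * Real.logb Λ 2 +
        Real.logb Λ V2) =
        3 / 5 + (m * Real.logb Λ Dτ + (60 * Real.logb Λ 2 + 2 * Real.logb Λ V2)) := by
      rw [hm]; ring
    calc (shapeCount c₁ c₂ c₃ X Y Z : ℝ) = Λ ^ Real.logb Λ (shapeCount c₁ c₂ c₃ X Y Z) :=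
          (Real.rpow_logb hΛ0 hΛ.ne' hBreal).symm
      _ ≤ Λ ^ (3 / 5 + 2 * ((12 * ((6 + e : ℕ) : ℝ) + 3) * Real.logb Λ Dτ + 30 * Real.logb Λ 2 +
            Real.logb Λ V2)) := Real.rpow_le_rpow_of_exponent_le hΛ.le hlog
      _ = Λ ^ (3 / 5 : ℝ) * ((Dτ : ℝ) ^ m * ((2 : ℝ) ^ (60 : ℝ) * (V2 : ℝ) ^ (2 : ℝ))) := by
          rw [e1, Real.rpow_add hΛ0, Real.rpow_add hΛ0, Real.rpow_add hΛ0, hpowlog m hDpos,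
            hpowlog 60 two_pos, hpowlog 2 hV2r]
  -- `D_τ^m ≤ C_τ^m T^η = C_τ^m V₂^η Λ^η`
  have hDm : (Dτ : ℝ) ^ m ≤ Cτ ^ m * ((V2 : ℝ) ^ η * Λ ^ η) := by
    calc (Dτ : ℝ) ^ m ≤ (Cτ * (T : ℝ) ^ (η / m)) ^ m :=
          Real.rpow_le_rpow (Nat.cast_nonneg _) hDreal hm0.le
      _ = Cτ ^ m * (T : ℝ) ^ η := by
          rw [Real.mul_rpow hCτ0.le (by positivity), ← Real.rpow_mul (Nat.cast_nonneg _),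
            div_mul_cancel₀ _ hm0.ne']
      _ = Cτ ^ m * ((V2 : ℝ) ^ η * Λ ^ η) := by rw [hT', Real.mul_rpow hV2r.le hΛ0.le]
  -- `Λ^{3/5} Λ^η = 2^{3/5+η} C₀^{3/5+η}`
  have hΛsplit : Λ ^ (3 / 5 : ℝ) * Λ ^ η = (2 : ℝ) ^ (3 / 5 + η) * (C₀ : ℝ) ^ (3 / 5 + η) := by
    rw [← Real.rpow_add hΛ0, hΛdef, Real.mul_rpow zero_le_two hC₀.le]
  have hW : (0 : ℝ) ≤ (2 : ℝ) ^ (60 : ℝ) * (V2 : ℝ) ^ (2 : ℝ) := by positivity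
  have hΛ35 : (0 : ℝ) ≤ Λ ^ (3 / 5 : ℝ) := by positivity
  calc (shapeCount c₁ c₂ c₃ X Y Z : ℝ)
        ≤ Λ ^ (3 / 5 : ℝ) * ((Dτ : ℝ) ^ m * ((2 : ℝ) ^ (60 : ℝ) * (V2 : ℝ) ^ (2 : ℝ))) := hstep
    _ ≤ Λ ^ (3 / 5 : ℝ) * ((Cτ ^ m * ((V2 : ℝ) ^ η * Λ ^ η)) * ((2 : ℝ) ^ (60 : ℝ) * (V2 : ℝ) ^ (2 : ℝ))) :=
        mul_le_mul_of_nonneg_left (mul_le_mul_of_nonneg_right hDm hW) hΛ35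
    _ = (2 : ℝ) ^ (3 / 5 + η) * ((2 : ℝ) ^ (60 : ℝ) * (V2 : ℝ) ^ (2 : ℝ)) * (Cτ ^ m * (V2 : ℝ) ^ η) *
          (C₀ : ℝ) ^ (3 / 5 + η) := by
        linear_combination ((2 : ℝ) ^ (60 : ℝ) * (V2 : ℝ) ^ (2 : ℝ)) * (Cτ ^ m * (V2 : ℝ) ^ η) * hΛsplit
    _ = K * (C₀ : ℝ) ^ (3 / 5 + η) := by rw [hK]

end AbcShapes

end Literature.NumberTheory.DiophantineGeometry
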